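import Literature.MathematicalPhysics.QuantumFieldTheory.BalabanImbrieJaffe1984to88.BIJ88Ineq5144BoundedSize309
import Literature.MathematicalPhysics.QuantumFieldTheory.BalabanImbrieJaffe1984to88.BIJ88WalkKernelCrude309
import Literature.MathematicalPhysics.QuantumFieldTheory.BalabanImbrieJaffe1984to88.BIJ88Ineq5144EndChainDecayToy
import Literature.MathematicalPhysics.QuantumFieldTheory.BalabanImbrieJaffe1984to88.BIJ88DsetNormBound306

/-!
# `BalabanImbrieJaffe1984to88.BIJ88Ineq5144BoundedSizeToy` — T. Bałaban, J. Imbrie, A. Jaffe, *Effective action and cluster properties of the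
abelian Higgs model*, Commun. Math. Phys. **114** (1988) 257–315 [BalabanImbrieJaffe1988], Sect. 5.14 (5.14.4) p. 309 [PDF 53] with Sect. 5.13
p. 305–307 [PDF 49–51]: **A KERNEL NON-VACUITY CERTIFICATE FOR THE BOUNDED-SIZE INSTANCE** `BIJ88Ineq5144BoundedSize309.
abs_locAct_actIn_le_rpow_of_card_le` AT `N₀ = 3` ON A COUPLED DATUM (owner design ruling v2.368; referee check (2)): the clause set of the
bounded-size instance — slot letters, walk-kernel certificates uniform in `s`, frame/source letters, `θS, θV ≤ ε θ^{β′N₀}`, the counting clause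
`hcnt` — is inhabited SIMULTANEOUSLY by: sites `Fin 4`, cubes `Fin 3`, blocks `![0,1,1,2]`, the coupled precision `Δ = 1 + 10⁻²·(path 0–1–2–3)`
of `BIJ88Ineq5144EndChainDecayToy` (`Δ ≻ 0`, `(98/100)·1 ≤ Δ ≤ (102/100)·1`), no χ-slots, ONE interaction slot in cube `0` with the
FIELD-DEPENDENT term `V(φ) = −log(1 + ½ sin(λφ₀))` (so `e^{−V} = 1 + ½ sin(λφ₀)` has the explicit all-orders letter `‖Dⁿe^{−V}‖ ≤ ½λⁿ`), no
source, corner `univ`, `t = 1`, `e_k = 1/20`, `θ = 1/10`, `β′ = 1`, `H = ∅`, every label map `γ′`, EVERY polymer `X″` with `2 ≤ |X″| ≤ 3`; the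
kernel letter `κ_c ≤ K₁ = (100/49)(25600/49)⁸` is DISCHARGED from the `Δ`-letters by `BIJ88WalkKernelCrude309.abs_prec_inv_mul_wker_apply_le`,
the counting clause by `ε = (2⁸·2⁸·20³·2·K₁³)⁻¹`, the `V`-letter by `BIJ88DsetNormBound306.abs_dset_single_le_of_bound` with `λ = θV = ε·10⁻³`.
* §1 `cbInf_of_periodic` (smooth periodic ⇒ `C_b^∞`), `hasDerivAt_sin_lin`, `iteratedDeriv_sin_lin`, `abs_iteratedDeriv_one_add_sin_le`;
* §2 the term and its letters (`cbInf_log_one_add_half_sin`, `norm_iteratedFDeriv_comp_site_le`, `uD_inr_eq`, `exists_letter_logSin`);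
* §3 `cnt_aux`, the certificate `abs_locAct_actIn_le_rpow_toy`.

statement-level skeleton of published theorems with citation tags; proofs where landed; nothing here is a claim about the Yang–Mills mass gap

PDF held: `paper:balaban1988-cmp114-bij-abelian-higgs-effective-action` (journal page = PDF page + 256); p. 309 (p0053 L19–28), p. 307 (p0051).
CITATION HEADER (lean-in-tree rule).  lit-balaban TYPED SKELETON (HOME `run/shared/lean/pub/lit-balaban/`), Phase 2, seat p36 (gen 22, unit
`lit-balaban-p36`); row **C2.Eq5.14.3-5.14.4** (member: non-vacuity certificate of the bounded-size instance) of `HOME/lit-balaban-r16/ROWS-C2-part2.md`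
(owner r16, referee ref-5).  Theorem-only; no definitions, no `Prop` facts; axioms standard.  HONEST SCOPE: non-vacuity only — tiny datum, `H = ∅`,
`t = 1`, no χ-slot (the χ-letters, shells and frame letter are inhabited vacuously; a χ-slot certificate needs a concrete `CutoffProfile`, NOT given);
the truncated activity of the datum is not claimed non-zero.  NOT summit progress; NOT continuum; NOT Clay.
-/

noncomputable section

namespace Literature.MathematicalPhysics.QuantumFieldTheory.BalabanImbrieJaffe1984to88.BIJ88Ineq5144BoundedSizeToy

open Finset Matrix Real
open scoped BigOperators
open BIJ88Sect5Statements (CutoffProfile)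
open BIJ88DirichletForms305 (interpForm)
open BIJ88PolymerRep5134 (corner)
open BIJ88SmoothFactors5133 (CbInf extCLM extCLM_apply)
open BIJ88WickSourceSmooth305 (dset)
open BIJ88DsetNormBound306 (abs_dset_single_le_of_bound)
open BIJ88RestrictedInteractionAllOrders308 (iteratedDeriv_expWeight)
open BIJ88SlotMoments308 (slotFactor_inr)
open BIJ88SlotMomentsGauss308 (uD)
open BIJ88Eq5145CornerModel (slotB slotY mem_slotY)
open BIJ88Eq5145CornerUrsell (cubeIn)
open BIJ88W6PrimeVsupp (actIn)
open BIJ88Ineq5144Located (locAct)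
open BIJ88Ineq5144EndChainDecayToy (toy_posDef_and_ge)
open BIJ88WalkKernelCrude309 (abs_prec_inv_mul_wker_apply_le)
open BIJ88Ineq5144BoundedSize309 (abs_locAct_actIn_le_rpow_of_card_le)

/-! ## §1  Smooth periodic functions of one variable; the trigonometric family -/

/-- a smooth periodic function of one variable is `C_b^∞` (each derivative is continuous and periodic, hence bounded). [folklore]
[cite: BalabanImbrieJaffe1988, §5.13 p.304] -/
theorem cbInf_of_periodic {g : ℝ → ℝ} (hg : ContDiff ℝ (⊤ : ℕ∞) g) {c : ℝ} (hc : 0 < c) (hp : Function.Periodic g c) :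
    CbInf g := by
  refine ⟨hg, fun n => ?_⟩
  have hcont : Continuous fun x => ‖iteratedFDeriv ℝ n g x‖ := (hg.continuous_iteratedFDeriv (mod_cast le_top)).norm
  have hper : Function.Periodic (fun x => ‖iteratedFDeriv ℝ n g x‖) c := fun x => by
    have h2 := iteratedFDeriv_comp_add_right (𝕜 := ℝ) (f := g) n c x
    rw [(funext hp : (fun y => g (y + c)) = g)] at h2
    simp only [h2]
  obtain ⟨x₀, -, hmax⟩ := isCompact_Icc.exists_isMaxOn (Set.nonempty_Icc.2 hc.le) hcont.continuousOn
  refine ⟨‖iteratedFDeriv ℝ n g x₀‖, fun x => ?_⟩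
  obtain ⟨y, hy, hxy⟩ := hper.exists_mem_Ico₀ hc x
  rw [hxy]; exact hmax (Set.Ico_subset_Icc_self hy)

/-- `(sin(λx + c))′ = λ sin(λx + c + π/2)`. [folklore] [cite: BalabanImbrieJaffe1988, §5.13 p.304] -/
theorem hasDerivAt_sin_lin (l c x : ℝ) : HasDerivAt (fun x => Real.sin (l * x + c)) (l * Real.sin (l * x + (c + π / 2))) x := by
  have h : HasDerivAt (fun x => l * x + c) l x := by simpa using ((hasDerivAt_id x).const_mul l).add_const c
  have h2 : HasDerivAt (fun x => Real.sin (l * x + c)) (Real.cos (l * x + c) * l) x := by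
    have := (Real.hasDerivAt_sin (l * x + c)).comp x h; exact this
  refine h2.congr_deriv ?_
  rw [show l * x + (c + π / 2) = (l * x + c) + π / 2 by ring, Real.sin_add_pi_div_two]
  ring

/-- all derivatives of `x ↦ κ sin(λx + c)`: `Dⁿ = κλⁿ sin(λx + c + nπ/2)`. [folklore] [cite: BalabanImbrieJaffe1988, §5.13 p.304] -/
theorem iteratedDeriv_sin_lin (l : ℝ) : ∀ (n : ℕ) (κ c : ℝ),
    iteratedDeriv n (fun x => κ * Real.sin (l * x + c)) = fun x => κ * l ^ n * Real.sin (l * x + (c + n * (π / 2))) := by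
  intro n
  induction n with
  | zero => intro κ c; funext x; simp
  | succ n ih =>
      intro κ c
      have hd : deriv (fun x => κ * Real.sin (l * x + c)) = fun x => (κ * l) * Real.sin (l * x + (c + π / 2)) := by
        funext x
        rw [((hasDerivAt_sin_lin l c x).const_mul κ).deriv]; ring
      rw [iteratedDeriv_succ', hd, ih (κ * l) (c + π / 2)]
      funext x
      rw [pow_succ]
      congr 1
      · ring
      · congr 1; push_cast; ring

/-- `|Dⁿ(1 + κ sin λx)| ≤ κλⁿ` for `n ≥ 1` (`κ, λ ≥ 0`). [folklore] [cite: BalabanImbrieJaffe1988, §5.13 p.304] -/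
theorem abs_iteratedDeriv_one_add_sin_le {κ l : ℝ} (hκ : 0 ≤ κ) (hl : 0 ≤ l) {n : ℕ} (hn : 1 ≤ n) (x : ℝ) :
    |iteratedDeriv n (fun x => 1 + κ * Real.sin (l * x)) x| ≤ κ * l ^ n := by
  have h1 : iteratedDeriv n (fun x => 1 + κ * Real.sin (l * x)) = iteratedDeriv n (fun x => κ * Real.sin (l * x + 0)) := by
    obtain ⟨k, rfl⟩ := Nat.exists_eq_add_of_le hn
    rw [add_comm 1 k, iteratedDeriv_succ', iteratedDeriv_succ']
    congr 1
    funext x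
    simp only [add_zero]
    rw [deriv_const_add]
  rw [h1, iteratedDeriv_sin_lin l n κ 0]
  simp only
  rw [abs_mul, abs_mul, abs_of_nonneg hκ, abs_of_nonneg (pow_nonneg hl _)]
  exact mul_le_of_le_one_right (by positivity) (Real.abs_sin_le_one _)

/-! ## §2  The term `V(φ) = −log(1 + ½ sin(λφ₀))` and its letters -/

/-- `1 + ½ sin(λx) > 0`. [folklore] [cite: BalabanImbrieJaffe1988, §5.13 p.304] -/
theorem one_add_half_sin_pos (l x : ℝ) : 0 < 1 + 1 / 2 * Real.sin (l * x) := by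
  have := Real.neg_one_le_sin (l * x); linarith

/-- `x ↦ 1 + ½ sin(λx)` is smooth and `2π/λ`-periodic, hence `C_b^∞`. [folklore] [cite: BalabanImbrieJaffe1988, §5.13 p.304] -/
theorem cbInf_one_add_half_sin {l : ℝ} (hl : 0 < l) : CbInf (fun x : ℝ => 1 + 1 / 2 * Real.sin (l * x)) := by
  refine cbInf_of_periodic (by fun_prop) (c := 2 * π / l) (by positivity) fun x => ?_
  show 1 + 1 / 2 * Real.sin (l * (x + 2 * π / l)) = 1 + 1 / 2 * Real.sin (l * x)
  rw [show l * (x + 2 * π / l) = l * x + 2 * π by field_simp, Real.sin_add_two_pi]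

/-- `x ↦ log(1 + ½ sin(λx))` is smooth and `2π/λ`-periodic, hence `C_b^∞`. [folklore] [cite: BalabanImbrieJaffe1988, §5.13 p.304] -/
theorem cbInf_log_one_add_half_sin {l : ℝ} (hl : 0 < l) : CbInf (fun x : ℝ => Real.log (1 + 1 / 2 * Real.sin (l * x))) := by
  refine cbInf_of_periodic ?_ (c := 2 * π / l) (by positivity) fun x => ?_
  · exact ContDiff.log (by fun_prop) fun x => (one_add_half_sin_pos l x).ne'
  · show Real.log (1 + 1 / 2 * Real.sin (l * (x + 2 * π / l))) = Real.log (1 + 1 / 2 * Real.sin (l * x))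
    rw [show l * (x + 2 * π / l) = l * x + 2 * π by field_simp, Real.sin_add_two_pi]

/-- the negative of a `C_b^∞` function is `C_b^∞`. [folklore] [cite: BalabanImbrieJaffe1988, §5.13 p.304] -/
theorem cbInf_neg {E : Type} [NormedAddCommGroup E] [NormedSpace ℝ E] {G : E → ℝ} (hG : CbInf G) : CbInf (fun φ => -G φ) := by
  have h := (CbInf.const (E := E) (-1)).mul hG
  simpa using h

/-- powers of a `C_b^∞` function are `C_b^∞`. [folklore] [cite: BalabanImbrieJaffe1988, §5.13 p.304] -/
theorem cbInf_pow {E : Type} [NormedAddCommGroup E] [NormedSpace ℝ E] {G : E → ℝ} (hG : CbInf G) (m : ℕ) :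
    CbInf (fun φ => G φ ^ m) := by
  have h := CbInf.prod (range m) (F := fun _ : ℕ => G) (fun _ _ => hG)
  simpa [prod_const, card_range] using h

variable {α I : Type} [Fintype α] [DecidableEq α] [Fintype I] [DecidableEq I] (blk : α → I)

omit [DecidableEq α] [Fintype I] in
/-- the evaluation of the extended field at a site, as a continuous linear map of norm `≤ 1`. [cite: BalabanImbrieJaffe1988, §5.13 p.306] -/
theorem norm_proj_comp_extCLM_le (X : Finset I) (x : α) :
    ‖(ContinuousLinearMap.proj (R := ℝ) x).comp (extCLM blk X)‖ ≤ 1 := by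
  refine ContinuousLinearMap.opNorm_le_bound _ zero_le_one fun ψ => ?_
  rw [ContinuousLinearMap.comp_apply, extCLM_apply, one_mul]
  simp only [ContinuousLinearMap.proj_apply, BIJ88PolymerRep5134Gauss.ext]
  split_ifs with h
  · exact norm_le_pi_norm ψ ⟨x, h⟩
  · rw [norm_zero]; exact norm_nonneg _

omit [DecidableEq α] [Fintype I] in
/-- **the all-orders letter of a one-site factor**: if `g : ℝ → ℝ` is smooth with `‖Dⁿg‖ ≤ b n`, `b ≥ 0`, then the field functional
`ψ ↦ g((ext ψ)(x))` on the sites of `X` has `‖Dⁿ‖ ≤ b n`. [cite: BalabanImbrieJaffe1988, §5.13 p.307, (5.14.3) p.309] -/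
theorem norm_iteratedFDeriv_comp_site_le (X : Finset I) (x : α) {g : ℝ → ℝ} (hg : ContDiff ℝ (⊤ : ℕ∞) g) {b : ℕ → ℝ}
    (hb0 : ∀ n, 0 ≤ b n) (hb : ∀ n y, ‖iteratedFDeriv ℝ n g y‖ ≤ b n) (n : ℕ) (ψ : BIJ88PolymerRep5134Gauss.Site blk X → ℝ) :
    ‖iteratedFDeriv ℝ n (fun ψ : BIJ88PolymerRep5134Gauss.Site blk X → ℝ => g (BIJ88PolymerRep5134Gauss.ext blk X ψ x)) ψ‖ ≤ b n := by
  set L := (ContinuousLinearMap.proj (R := ℝ) x).comp (extCLM blk X) with hL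
  have hfun : (fun ψ : BIJ88PolymerRep5134Gauss.Site blk X → ℝ => g (BIJ88PolymerRep5134Gauss.ext blk X ψ x)) = g ∘ L := by
    funext ψ
    simp only [Function.comp, hL, ContinuousLinearMap.comp_apply, extCLM_apply, ContinuousLinearMap.proj_apply]
  rw [hfun, L.iteratedFDeriv_comp_right hg ψ (mod_cast le_top)]
  refine (ContinuousMultilinearMap.norm_compContinuousLinearMap_le _ _).trans ?_
  rw [prod_const, card_univ, Fintype.card_fin]
  calc ‖iteratedFDeriv ℝ n g (L ψ)‖ * ‖L‖ ^ n ≤ b n * 1 ^ n :=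
        mul_le_mul (hb n _) (pow_le_pow_left₀ (norm_nonneg _) (norm_proj_comp_extCLM_le blk X x) n) (by positivity) (hb0 n)
    _ = b n := by rw [one_pow, mul_one]

omit [Fintype α] [DecidableEq α] [Fintype I] [DecidableEq I] in
/-- the derivative factors of an interaction slot: `∂_t^m e^{−tV_Y(φ)} = (−V_Y(φ))^m e^{−tV_Y(φ)}`. [cite: BalabanImbrieJaffe1988, (5.14.2) p.308] -/
theorem uD_inr_eq (χ : CutoffProfile) {ι υ : Type*} [DecidableEq ι] [DecidableEq υ] (p ek : ℝ) (B : Finset ι)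
    (Φ : ι → (α → ℝ) → ℝ) (c : ι → ℝ) (Ys : Finset υ) (V : υ → (α → ℝ) → ℝ) (t : ℝ) (Y : ↥Ys) (m : ℕ) (φ : α → ℝ) :
    uD χ p ek B Φ c Ys V t (Sum.inr Y) m φ = (-(V Y φ)) ^ m * Real.exp (-(t * V Y φ)) := by
  rw [uD, slotFactor_inr, iteratedDeriv_expWeight]

omit [Fintype I] in
/-- **THE ALL-ORDERS LETTER OF THE TERM `V = −log(1 + ½ sin(λφ_x))` AT `t = 1`**: sizes `A_Y(m,n) ≥ 0`, `A_Y(0,0) = 3/2`, `A_Y(0,n) = ½λⁿ`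
(`n ≥ 1`), with `|∂_{q_D}[(−V)^m e^{−V}](φ)| ≤ A_Y(m,|D|)` for all `m`, `D` (orders `m ≥ 1` by `C_b^∞`, order `0` explicitly: `e^{−V} = 1 + ½ sin(λφ_x)`).
[cite: BalabanImbrieJaffe1988, §5.13 p.307 L2–3, (5.14.3) p.309] -/
theorem exists_letter_logSin (χ : CutoffProfile) {ι υ : Type*} [DecidableEq ι] [DecidableEq υ] (p ek : ℝ) (B : Finset ι)
    (Φ : ι → (α → ℝ) → ℝ) (c : ι → ℝ) (Ys : Finset υ) (V : υ → (α → ℝ) → ℝ) (X'' : Finset I) (x : α) {l : ℝ} (hl : 0 < l)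
    (hV : ∀ (Y : ↥Ys) (φ : α → ℝ), V Y φ = -Real.log (1 + 1 / 2 * Real.sin (l * φ x))) :
    ∃ AY : ℕ → ℕ → ℝ, (∀ m n, 0 ≤ AY m n) ∧ AY 0 0 = 3 / 2 ∧ (∀ n, 1 ≤ n → AY 0 n = 1 / 2 * l ^ n) ∧
      ∀ (Y : ↥Ys) (κ : Type) [LinearOrder κ] (q : κ → BIJ88PolymerRep5134Gauss.Site blk X'') (m : ℕ) (D' : Finset κ)
        (φ : BIJ88PolymerRep5134Gauss.Site blk X'' → ℝ),
        |dset (fun j => Pi.single (q j) (1 : ℝ)) D'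
          (fun ψ => uD χ p ek B Φ c Ys V 1 (Sum.inr Y) m (BIJ88PolymerRep5134Gauss.ext blk X'' ψ)) φ| ≤ AY m D'.card := by
  -- the factors as explicit functions of the located field
  have e : ∀ (Y : ↥Ys) (m : ℕ), (fun ψ : BIJ88PolymerRep5134Gauss.Site blk X'' → ℝ =>
      uD χ p ek B Φ c Ys V 1 (Sum.inr Y) m (BIJ88PolymerRep5134Gauss.ext blk X'' ψ)) = fun ψ =>
      Real.log (1 + 1 / 2 * Real.sin (l * BIJ88PolymerRep5134Gauss.ext blk X'' ψ x)) ^ m *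
        (1 + 1 / 2 * Real.sin (l * BIJ88PolymerRep5134Gauss.ext blk X'' ψ x)) := fun Y m => by
    funext ψ
    rw [uD_inr_eq, hV, neg_neg, one_mul, neg_neg, Real.exp_log (one_add_half_sin_pos _ _)]
  have hcb : ∀ m : ℕ, CbInf (fun ψ : BIJ88PolymerRep5134Gauss.Site blk X'' → ℝ =>
      Real.log (1 + 1 / 2 * Real.sin (l * BIJ88PolymerRep5134Gauss.ext blk X'' ψ x)) ^ m *
        (1 + 1 / 2 * Real.sin (l * BIJ88PolymerRep5134Gauss.ext blk X'' ψ x))) := fun m => by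
    have h1 := ((cbInf_pow (cbInf_log_one_add_half_sin hl) m).mul (cbInf_one_add_half_sin hl)).comp_clm
      ((ContinuousLinearMap.proj (R := ℝ) x).comp (extCLM blk X''))
    simpa only [ContinuousLinearMap.comp_apply, extCLM_apply, ContinuousLinearMap.proj_apply] using h1
  have hK : ∀ m n : ℕ, ∃ K : ℝ, 0 ≤ K ∧ ∀ φ, ‖iteratedFDeriv ℝ n (fun ψ : BIJ88PolymerRep5134Gauss.Site blk X'' → ℝ =>
      Real.log (1 + 1 / 2 * Real.sin (l * BIJ88PolymerRep5134Gauss.ext blk X'' ψ x)) ^ m *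
        (1 + 1 / 2 * Real.sin (l * BIJ88PolymerRep5134Gauss.ext blk X'' ψ x))) φ‖ ≤ K := fun m n => by
    obtain ⟨K, hK0, hK⟩ := (hcb m).bound_le n; exact ⟨K, hK0, fun φ => hK n le_rfl φ⟩
  choose K hK0 hK using hK
  -- the explicit letter of order `0`
  have hb0 : ∀ n : ℕ, 0 ≤ (if n = 0 then 3 / 2 else 1 / 2 * l ^ n : ℝ) := fun n => by split_ifs <;> positivity
  have hb : ∀ (n : ℕ) (ψ : BIJ88PolymerRep5134Gauss.Site blk X'' → ℝ),
      ‖iteratedFDeriv ℝ n (fun ψ : BIJ88PolymerRep5134Gauss.Site blk X'' → ℝ =>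
        1 + 1 / 2 * Real.sin (l * BIJ88PolymerRep5134Gauss.ext blk X'' ψ x)) ψ‖ ≤ (if n = 0 then 3 / 2 else 1 / 2 * l ^ n : ℝ) :=
    norm_iteratedFDeriv_comp_site_le blk X'' x (g := fun y => 1 + 1 / 2 * Real.sin (l * y)) (by fun_prop)
      (b := fun n => if n = 0 then 3 / 2 else 1 / 2 * l ^ n) hb0 fun n y => by
        split_ifs with hn
        · subst hn
          rw [norm_iteratedFDeriv_zero, Real.norm_eq_abs]
          have h1 := Real.sin_le_one (l * y); have h2 := Real.neg_one_le_sin (l * y)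
          rw [abs_le]; constructor <;> linarith
        · rw [norm_iteratedFDeriv_eq_norm_iteratedDeriv, Real.norm_eq_abs]
          exact abs_iteratedDeriv_one_add_sin_le (by norm_num) hl.le (Nat.one_le_iff_ne_zero.2 hn) y
  refine ⟨fun m n => if m = 0 then (if n = 0 then 3 / 2 else 1 / 2 * l ^ n) else K m n, fun m n => ?_, by simp, fun n hn => ?_, ?_⟩
  · show 0 ≤ (if m = 0 then (if n = 0 then 3 / 2 else 1 / 2 * l ^ n) else K m n : ℝ)
    split_ifs <;> first | positivity | exact hK0 _ _
  · show (if (0 : ℕ) = 0 then (if n = 0 then 3 / 2 else 1 / 2 * l ^ n) else K 0 n : ℝ) = 1 / 2 * l ^ n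
    simp [Nat.one_le_iff_ne_zero.1 hn]
  intro Y κ _ q m D' φ
  rw [e Y m]
  rcases Nat.eq_zero_or_pos m with rfl | hm
  · have hcd : ContDiff ℝ (⊤ : ℕ∞) (fun ψ : BIJ88PolymerRep5134Gauss.Site blk X'' → ℝ =>
        1 + 1 / 2 * Real.sin (l * BIJ88PolymerRep5134Gauss.ext blk X'' ψ x)) := by
      simpa only [pow_zero, one_mul] using (hcb 0).1
    simp only [pow_zero, one_mul, if_true]
    exact abs_dset_single_le_of_bound q D' hcd (B := fun n _ => if n = 0 then 3 / 2 else 1 / 2 * l ^ n) (fun n ψ => hb n ψ) φ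
  · simp only [if_neg hm.ne']
    exact abs_dset_single_le_of_bound q D' (hcb m).1 (B := fun n _ => K m n) (fun n ψ => hK m n ψ) φ

/-! ## §3  The certificate -/

/-- positivity-free bookkeeping of the counting clause: `2^{2^3}·2^{2^3}·(4 + 4²)^3·1^{2·3}·k^3·1·2·(2⁸·2⁸·20³·2·k³)⁻¹ ≤ 1` (`k > 0`). [folklore]
[cite: BalabanImbrieJaffe1988, §5.13 p.307 L20–23] -/
theorem cnt_aux {k : ℝ} (hk : 0 < k) :
    (2 : ℝ) ^ 2 ^ 3 * (2 : ℝ) ^ 2 ^ 3 * ((4 : ℕ) + ((4 : ℕ) : ℝ) ^ 2) ^ 3 * ((1 : ℕ) : ℝ) ^ (2 * 3) * k ^ 3 * (1 : ℝ) ^ (1 : ℕ) *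
        (2 : ℝ) ^ (1 : ℕ) * ((2 : ℝ) ^ 8 * 2 ^ 8 * 20 ^ 3 * 2 * k ^ 3)⁻¹ ≤ 1 := by
  have h3 : 0 < k ^ 3 := pow_pos hk 3
  rw [show (2 : ℝ) ^ 2 ^ 3 * (2 : ℝ) ^ 2 ^ 3 * ((4 : ℕ) + ((4 : ℕ) : ℝ) ^ 2) ^ 3 * ((1 : ℕ) : ℝ) ^ (2 * 3) * k ^ 3 * (1 : ℝ) ^ (1 : ℕ) *
      (2 : ℝ) ^ (1 : ℕ) = (2 : ℝ) ^ 8 * 2 ^ 8 * 20 ^ 3 * 2 * k ^ 3 by norm_num; ring]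
  rw [mul_inv_cancel₀ (by positivity)]

/-- **NON-VACUITY OF THE BOUNDED-SIZE INSTANCE AT `N₀ = 3` ON A COUPLED DATUM**: `BIJ88Ineq5144BoundedSize309.abs_locAct_actIn_le_rpow_of_card_le`
on the datum of the module docstring (`m = 98/100`, `C₀ = 102/100`, `e_k = 1/20`, `t = 1`, `θ = 1/10`, `β′ = 1`, `H = ∅`), every binder inhabited and
every hypothesis — the kernel certificates for all `s`, the `V`-letter, the counting clause — discharged by the kernel: for every label map `γ′` and
EVERY polymer `X″` with `2 ≤ |X″| ≤ 3`, `|locAct (□∘γ′) g₃ (∅, X″)| ≤ (1/10)^{0 + 1·|X″∖∅|}`. [cite: BalabanImbrieJaffe1988, (5.14.4) p.309 L19–28; §5.13 p.307] -/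
theorem abs_locAct_actIn_le_rpow_toy (adj : Fin 3 → Fin 3 → Prop) [DecidableRel adj] (χ : CutoffProfile) (p : ℝ) {S : Type*}
    [DecidableEq S]
    (γ' : S → ↥(slotB (∅ : Finset Unit) (univ : Finset Unit) (fun _ : ↥(∅ : Finset Unit) ⊕ ↥(univ : Finset Unit) => (0 : Fin 3))
        (univ : Finset (Fin 3))) ⊕
      ↥(slotY (∅ : Finset Unit) (univ : Finset Unit) (fun _ : ↥(∅ : Finset Unit) ⊕ ↥(univ : Finset Unit) => (0 : Fin 3))
        (univ : Finset (Fin 3))))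
    (X'' : Finset (Fin 3)) (h2 : 2 ≤ X''.card) (h3 : X''.card ≤ 3) :
    |locAct (cubeIn (fun _ : ↥(∅ : Finset Unit) ⊕ ↥(univ : Finset Unit) => (0 : Fin 3)) (univ : Finset (Fin 3)) ∘ γ')
        (actIn (![0, 1, 1, 2] : Fin 4 → Fin 3)
          (!![1, 1 / 100, 0, 0; 1 / 100, 1, 1 / 100, 0; 0, 1 / 100, 1, 1 / 100; 0, 0, 1 / 100, 1] : Matrix (Fin 4) (Fin 4) ℝ)
          (fun _ : Fin 4 => (0 : ℝ)) adj χ p (1 / 20) (∅ : Finset Unit) (fun (_ : Unit) (_ : Fin 4 → ℝ) => (0 : ℝ))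
          (fun _ : Unit => (1 : ℝ)) (univ : Finset Unit)
          (fun (_ : Unit) (φ : Fin 4 → ℝ) =>
            -Real.log (1 + 1 / 2 * Real.sin (((2 : ℝ) ^ 8 * 2 ^ 8 * 20 ^ 3 * 2 * (100 / 49 * (25600 / 49) ^ 8) ^ 3)⁻¹ / 1000 * φ 0)))
          (fun _ : ↥(∅ : Finset Unit) ⊕ ↥(univ : Finset Unit) => (0 : Fin 3)) (univ : Finset (Fin 3)) (univ : Finset (Fin 3)) 1 γ')
        (∅ : Finset S) X''| ≤
      (1 / 10 : ℝ) ^ (((∅ : Finset S).card : ℝ) + 1 * ((X'' \ (∅ : Finset S).image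
        (cubeIn (fun _ : ↥(∅ : Finset Unit) ⊕ ↥(univ : Finset Unit) => (0 : Fin 3)) (univ : Finset (Fin 3)) ∘ γ')).card : ℝ)) := by
  obtain ⟨hΔ, hΔm⟩ := toy_posDef_and_ge
  -- the precision: upper letter and entries
  have hCΔ : ∀ v : Fin 4 → ℝ,
      v ⬝ᵥ ((!![1, 1 / 100, 0, 0; 1 / 100, 1, 1 / 100, 0; 0, 1 / 100, 1, 1 / 100; 0, 0, 1 / 100, 1] : Matrix (Fin 4) (Fin 4) ℝ) *ᵥ v) ≤
        (102 / 100) * (v ⬝ᵥ v) := fun v => by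
    have hq : v ⬝ᵥ ((!![1, 1 / 100, 0, 0; 1 / 100, 1, 1 / 100, 0; 0, 1 / 100, 1, 1 / 100; 0, 0, 1 / 100, 1] :
        Matrix (Fin 4) (Fin 4) ℝ) *ᵥ v) = v 0 ^ 2 + v 1 ^ 2 + v 2 ^ 2 + v 3 ^ 2 + (2 / 100) * (v 0 * v 1 + v 1 * v 2 + v 2 * v 3) := by
      simp [Matrix.mulVec, dotProduct, Fin.sum_univ_four]; ring
    have hn : v ⬝ᵥ v = v 0 ^ 2 + v 1 ^ 2 + v 2 ^ 2 + v 3 ^ 2 := by simp [dotProduct, Fin.sum_univ_four]; ring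
    rw [hq, hn]
    nlinarith [sq_nonneg (v 0 - v 1), sq_nonneg (v 1 - v 2), sq_nonneg (v 2 - v 3), sq_nonneg (v 0), sq_nonneg (v 3)]
  have hh : ∀ x y : Fin 4,
      |(!![1, 1 / 100, 0, 0; 1 / 100, 1, 1 / 100, 0; 0, 1 / 100, 1, 1 / 100; 0, 0, 1 / 100, 1] : Matrix (Fin 4) (Fin 4) ℝ) x y| ≤ 1 := by
    intro x y
    fin_cases x <;> fin_cases y <;> simp [abs_of_nonneg] <;> norm_num
  -- a site of `X″`
  have hXs : ∃ x : Fin 4, (![0, 1, 1, 2] : Fin 4 → Fin 3) x ∈ X'' := by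
    obtain ⟨i, hi⟩ := card_pos.1 (lt_of_lt_of_le two_pos h2)
    fin_cases i
    exacts [⟨0, by simpa using hi⟩, ⟨1, by simpa using hi⟩, ⟨3, by simpa using hi⟩]
  -- the constants
  have hK1 : (1 : ℝ) ≤ 100 / 49 * (25600 / 49) ^ 8 := by norm_num
  have hC1 : (1 : ℝ) ≤ (2 : ℝ) ^ 8 * 2 ^ 8 * 20 ^ 3 * 2 * (100 / 49 * (25600 / 49) ^ 8) ^ 3 := by
    nlinarith [(one_le_pow₀ hK1 : (1 : ℝ) ≤ (100 / 49 * (25600 / 49) ^ 8) ^ 3)]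
  have hε0 : (0 : ℝ) ≤ ((2 : ℝ) ^ 8 * 2 ^ 8 * 20 ^ 3 * 2 * (100 / 49 * (25600 / 49) ^ 8) ^ 3)⁻¹ := by positivity
  have hε1 : ((2 : ℝ) ^ 8 * 2 ^ 8 * 20 ^ 3 * 2 * (100 / 49 * (25600 / 49) ^ 8) ^ 3)⁻¹ ≤ 1 := inv_le_one_of_one_le₀ hC1
  have hl0 : (0 : ℝ) < ((2 : ℝ) ^ 8 * 2 ^ 8 * 20 ^ 3 * 2 * (100 / 49 * (25600 / 49) ^ 8) ^ 3)⁻¹ / 1000 := by positivity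
  have hl1 : ((2 : ℝ) ^ 8 * 2 ^ 8 * 20 ^ 3 * 2 * (100 / 49 * (25600 / 49) ^ 8) ^ 3)⁻¹ / 1000 ≤ 1 / 10 := by linarith
  -- the interaction slot and its letter
  have hVcb : CbInf (fun φ : Fin 4 → ℝ =>
      -Real.log (1 + 1 / 2 * Real.sin (((2 : ℝ) ^ 8 * 2 ^ 8 * 20 ^ 3 * 2 * (100 / 49 * (25600 / 49) ^ 8) ^ 3)⁻¹ / 1000 * φ 0))) := by
    have h1 := (cbInf_neg (cbInf_log_one_add_half_sin hl0)).comp_clm (ContinuousLinearMap.proj (R := ℝ) (φ := fun _ : Fin 4 => ℝ) (0 : Fin 4))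
    simpa only [ContinuousLinearMap.proj_apply] using h1
  obtain ⟨AY, hAY0, hAY00, hAY0n, hAYlet⟩ := exists_letter_logSin (![0, 1, 1, 2] : Fin 4 → Fin 3) χ p (1 / 20)
    (slotB (∅ : Finset Unit) (univ : Finset Unit) (fun _ : ↥(∅ : Finset Unit) ⊕ ↥(univ : Finset Unit) => (0 : Fin 3))
      (univ : Finset (Fin 3)))
    (fun b : ↥(∅ : Finset Unit) => (fun (_ : Unit) (_ : Fin 4 → ℝ) => (0 : ℝ)) b) (fun b : ↥(∅ : Finset Unit) => (fun _ : Unit => (1 : ℝ)) b)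
    (slotY (∅ : Finset Unit) (univ : Finset Unit) (fun _ : ↥(∅ : Finset Unit) ⊕ ↥(univ : Finset Unit) => (0 : Fin 3))
      (univ : Finset (Fin 3)))
    (fun Y : ↥(univ : Finset Unit) => (fun (_ : Unit) (φ : Fin 4 → ℝ) =>
      -Real.log (1 + 1 / 2 * Real.sin (((2 : ℝ) ^ 8 * 2 ^ 8 * 20 ^ 3 * 2 * (100 / 49 * (25600 / 49) ^ 8) ^ 3)⁻¹ / 1000 * φ 0))) Y)
    X'' (0 : Fin 4) hl0 (fun _ _ => rfl)
  -- the unique slot, to park the non-legs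
  have hY₀ : (⟨(), mem_univ _⟩ : ↥(univ : Finset Unit)) ∈
      slotY (∅ : Finset Unit) (univ : Finset Unit) (fun _ : ↥(∅ : Finset Unit) ⊕ ↥(univ : Finset Unit) => (0 : Fin 3))
        (univ : Finset (Fin 3)) := by rw [mem_slotY]; exact mem_univ _
  -- sizes of the site and slot types
  have hnX : Fintype.card (BIJ88PolymerRep5134Gauss.Site (![0, 1, 1, 2] : Fin 4 → Fin 3) X'') ≤ 4 :=
    (Fintype.card_subtype_le _).trans (by simp)
  haveI hBe : IsEmpty ↥(slotB (∅ : Finset Unit) (univ : Finset Unit)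
      (fun _ : ↥(∅ : Finset Unit) ⊕ ↥(univ : Finset Unit) => (0 : Fin 3)) (univ : Finset (Fin 3))) :=
    ⟨fun b => notMem_empty _ b.1.2⟩
  have hGX : (univ.filter fun τ : ↥(slotB (∅ : Finset Unit) (univ : Finset Unit)
        (fun _ : ↥(∅ : Finset Unit) ⊕ ↥(univ : Finset Unit) => (0 : Fin 3)) (univ : Finset (Fin 3))) ⊕
      ↥(slotY (∅ : Finset Unit) (univ : Finset Unit) (fun _ : ↥(∅ : Finset Unit) ⊕ ↥(univ : Finset Unit) => (0 : Fin 3))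
        (univ : Finset (Fin 3))) =>
      cubeIn (fun _ : ↥(∅ : Finset Unit) ⊕ ↥(univ : Finset Unit) => (0 : Fin 3)) (univ : Finset (Fin 3)) τ ∈ X'').card ≤ 1 := by
    refine (card_le_univ _).trans ?_
    rw [Fintype.card_sum, Fintype.card_eq_zero, zero_add]
    exact (Fintype.card_le_of_injective (fun Y => Y.1) Subtype.val_injective).trans (by simp)
  -- the kernel letter bound `κ_c ≤ K₁`
  have hκ1 : ∀ cg : Finset (Finset (Fin 3)),
      2 / (98 / 100 : ℝ) * (2 / (98 / 100 : ℝ) * Fintype.card (BIJ88PolymerRep5134Gauss.Site (![0, 1, 1, 2] : Fin 4 → Fin 3) X'') *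
        (2 * (Fintype.card (BIJ88PolymerRep5134Gauss.Site (![0, 1, 1, 2] : Fin 4 → Fin 3) X'') * (1 : ℝ))) *
          2 ^ Fintype.card (Fin 3)) ^ cg.card ≤ 100 / 49 * (25600 / 49) ^ 8 := by
    intro cg
    have hn4 : (Fintype.card (BIJ88PolymerRep5134Gauss.Site (![0, 1, 1, 2] : Fin 4 → Fin 3) X'') : ℝ) ≤ 4 := by exact_mod_cast hnX
    have hn0 : (0 : ℝ) ≤ Fintype.card (BIJ88PolymerRep5134Gauss.Site (![0, 1, 1, 2] : Fin 4 → Fin 3) X'') := Nat.cast_nonneg _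
    have hc8 : cg.card ≤ 8 := (card_le_univ cg).trans (by simp [Fintype.card_finset])
    rw [Fintype.card_fin]
    have hbase : 2 / (98 / 100 : ℝ) * Fintype.card (BIJ88PolymerRep5134Gauss.Site (![0, 1, 1, 2] : Fin 4 → Fin 3) X'') *
        (2 * (Fintype.card (BIJ88PolymerRep5134Gauss.Site (![0, 1, 1, 2] : Fin 4 → Fin 3) X'') * (1 : ℝ))) * 2 ^ 3 ≤ 25600 / 49 := by
      nlinarith
    calc 2 / (98 / 100 : ℝ) * (2 / (98 / 100 : ℝ) * Fintype.card (BIJ88PolymerRep5134Gauss.Site (![0, 1, 1, 2] : Fin 4 → Fin 3) X'') *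
          (2 * (Fintype.card (BIJ88PolymerRep5134Gauss.Site (![0, 1, 1, 2] : Fin 4 → Fin 3) X'') * (1 : ℝ))) * 2 ^ 3) ^ cg.card
        ≤ 2 / (98 / 100 : ℝ) * (25600 / 49) ^ cg.card :=
          mul_le_mul_of_nonneg_left (pow_le_pow_left₀ (by positivity) hbase _) (by norm_num)
      _ ≤ 2 / (98 / 100 : ℝ) * (25600 / 49) ^ 8 := mul_le_mul_of_nonneg_left (pow_le_pow_right₀ (by norm_num) hc8) (by norm_num)
      _ = 100 / 49 * (25600 / 49) ^ 8 := by norm_num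
  -- smallness clauses
  have hSε : ((2 : ℝ) ^ 8 * 2 ^ 8 * 20 ^ 3 * 2 * (100 / 49 * (25600 / 49) ^ 8) ^ 3)⁻¹ / 1000 ≤
      ((2 : ℝ) ^ 8 * 2 ^ 8 * 20 ^ 3 * 2 * (100 / 49 * (25600 / 49) ^ 8) ^ 3)⁻¹ * (1 / 10 : ℝ) ^ ((1 : ℝ) * ((3 : ℕ) : ℝ)) := by
    rw [one_mul, Real.rpow_natCast]; norm_num
  exact abs_locAct_actIn_le_rpow_of_card_le (![0, 1, 1, 2] : Fin 4 → Fin 3)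
    (!![1, 1 / 100, 0, 0; 1 / 100, 1, 1 / 100, 0; 0, 1 / 100, 1, 1 / 100; 0, 0, 1 / 100, 1] : Matrix (Fin 4) (Fin 4) ℝ)
    (fun _ : Fin 4 => (0 : ℝ)) χ p (∅ : Finset Unit) (univ : Finset Unit)
    (fun _ : ↥(∅ : Finset Unit) ⊕ ↥(univ : Finset Unit) => (0 : Fin 3)) adj (univ : Finset (Fin 3)) hΔ (m := 98 / 100) (by norm_num) hΔm
    hCΔ (ek := 1 / 20) (t := 1) (by norm_num) one_pos (by norm_num) (fun b hb => absurd hb (notMem_empty _))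
    (fun b hb => absurd hb (notMem_empty _)) (fun _ _ => hVcb) (univ : Finset (Fin 3)) γ' ∅ h2 hXs
    (Sum.inr ⟨⟨(), mem_univ _⟩, hY₀⟩) (Λ := 1) one_pos
    (fun θ φ => by simp only [mul_zero, sum_const_zero, abs_zero]; positivity)
    (F := 0) le_rfl
    (by rw [show BIJ88PolymerRep5134Gauss.src (![0, 1, 1, 2] : Fin 4 → Fin 3) (fun _ : Fin 4 => (0 : ℝ)) X'' = 0 from funext fun _ => rfl]
        simp)
    (a := fun _ => 0) (a' := fun _ => 0) (fun _ => le_rfl)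
    (A := fun τ m n => Sum.elim (fun _ => (1 : ℝ)) (fun _ => AY m n) τ)
    (fun τ m n => by rcases τ with b | Y <;> simp [hAY0]) (fun b => (hBe.false b).elim)
    (w := fun _ _ => 1) (fun _ _ => zero_le_one) (fun κ _ q b => (hBe.false b).elim)
    (fun κ _ q Y m D' φ => by
      simp only [Sum.elim_inr, prod_const_one, mul_one]
      exact hAYlet Y κ q m D' φ)
    (κc := fun cg _ _ => 2 / (98 / 100 : ℝ) * (2 / (98 / 100 : ℝ) *
      Fintype.card (BIJ88PolymerRep5134Gauss.Site (![0, 1, 1, 2] : Fin 4 → Fin 3) X'') *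
        (2 * (Fintype.card (BIJ88PolymerRep5134Gauss.Site (![0, 1, 1, 2] : Fin 4 → Fin 3) X'') * (1 : ℝ))) *
          2 ^ Fintype.card (Fin 3)) ^ cg.card)
    (fun s hs cg x y => abs_prec_inv_mul_wker_apply_le (![0, 1, 1, 2] : Fin 4 → Fin 3) _ hΔ (by norm_num) hΔm zero_le_one hh
      (univ : Finset (Fin 3)) X'' hs cg x y)
    (Fq := fun _ => 0) (fun q => by simp) (N₀ := 3) (M := 0) (nX := 4) (GX := 1) h3 (by simp) hnX hGX le_rfl le_rfl
    (fun _ _ => le_rfl) (K₁ := 100 / 49 * (25600 / 49) ^ 8) (F₀ := 0) hK1 (fun cg x y => hκ1 cg) (fun _ => le_rfl) (by simp)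
    (θ := 1 / 10) (θS := ((2 : ℝ) ^ 8 * 2 ^ 8 * 20 ^ 3 * 2 * (100 / 49 * (25600 / 49) ^ 8) ^ 3)⁻¹ / 1000)
    (θV := ((2 : ℝ) ^ 8 * 2 ^ 8 * 20 ^ 3 * 2 * (100 / 49 * (25600 / 49) ^ 8) ^ 3)⁻¹ / 1000) (Aχ := 1) (AV := 2)
    (ε := ((2 : ℝ) ^ 8 * 2 ^ 8 * 20 ^ 3 * 2 * (100 / 49 * (25600 / 49) ^ 8) ^ 3)⁻¹) (β' := 1)
    (by norm_num) (by norm_num) hl0.le (hl1.trans (by norm_num)) hl0.le hl1 le_rfl (by norm_num) hε0 zero_le_one hSε hSε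
    (fun b => (hBe.false b).elim) (fun b => (hBe.false b).elim)
    (fun Y md nd hmd hnd => by
      obtain rfl : md = 0 := Nat.le_zero.1 hmd
      simp only [Sum.elim_inr, zero_add]
      rcases Nat.eq_zero_or_pos nd with rfl | hnd1
      · rw [hAY00, pow_zero]; norm_num
      · rw [hAY0n nd hnd1]
        exact mul_le_mul_of_nonneg_right (by norm_num) (pow_nonneg hl0.le _))
    (fun b => (hBe.false b).elim) (by simpa using cnt_aux (zero_lt_one.trans_le hK1))

end Literature.MathematicalPhysics.QuantumFieldTheory.BalabanImbrieJaffe1984to88.BIJ88Ineq5144BoundedSizeToy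

end
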